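import Summits.HodgeConjecture.HodgeConjecture.Theses.DerivedTorelliFermat

/-!
# Strategist census — best typed split of `ResidualSectorComplement` (stmt-HodgeConjecture-13828)

NOT filed at route level (see STRATEGY-CENSUS.md `## Decomposition`): piece `SummitOffFermatFourfolds`
is the complement proper (summit-strength, no plan), and piece `ResidualDischarge` is owned by the
sibling crux `PadicSemiregularLift.HodgeFermatVarieties` (stmt-HodgeConjecture-1334, engine slot S4).
This file only certifies that the split is TYPED and that the seam is proved.
-/

namespace Summit.HodgeConjecture.HodgeConjecture.Cruxes.ResidualSectorComplement.StrategistCensus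

open Summit.HodgeConjecture.HodgeConjecture.Theses.DerivedTorelliFermat

/-- HC for every smooth projective Fermat fourfold of positive degree (the `n = 4` slice of the sibling
crux `PadicSemiregularLift.HodgeFermatVarieties`). -/
def FermatFourfoldsHC : Prop :=
  ∀ (m : ℕ) [NeZero m] (X : Literature.AlgebraicGeometry.Motives.SchemeOver ℂ),
    Literature.AlgebraicGeometry.Motives.IsFermatVariety 4 m X →
    Literature.AlgebraicGeometry.Motives.IsSmoothProjective 4 X →
    Literature.AlgebraicGeometry.HodgeTheory.HodgeConjectureFor 4 X

/-- Piece 1 (the residual sector is dischargeable): granted the route target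
`FermatFourfoldsHCModResidual` (HC for `X⁴ₘ` modulo the residual eigenlines), HC holds for all Fermat
fourfolds — i.e. the residual eigenlines (death-table classes `m = 70, 110, 114, …`) are algebraic. -/
def ResidualDischarge : Prop := FermatFourfoldsHCModResidual → FermatFourfoldsHC

/-- Piece 2 (the complement proper): HC granted HC for all Fermat fourfolds — verbatim the registered
stub statement `Birth.SummitGrantedFermatFourfolds`. -/
def SummitOffFermatFourfolds : Prop := FermatFourfoldsHC → _root_.HodgeConjecture

/-- The seam (modus ponens). -/
theorem ResidualSectorComplement_of_subs :
    ResidualDischarge → SummitOffFermatFourfolds → ResidualSectorComplement :=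
  fun h₁ h₂ hT => h₂ (h₁ hT)

/-- Converse bookkeeping: the crux gives piece 2 outright only together with piece 1's converse
direction, which is trivial (`FermatFourfoldsHC → FermatFourfoldsHCModResidual` drops a hypothesis). -/
theorem fermatFourfoldsHCModResidual_of_fermatFourfoldsHC :
    FermatFourfoldsHC → FermatFourfoldsHCModResidual :=
  fun h m _ _ X hF hX => h m X hF hX

theorem summitOffFermatFourfolds_of_crux :
    ResidualSectorComplement → SummitOffFermatFourfolds :=
  fun hC hFF => hC (fermatFourfoldsHCModResidual_of_fermatFourfoldsHC hFF)

/-- Hence piece 2 is EQUIVALENT to the crux given piece 1, and piece 2 alone already carries the whole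
difficulty off the Fermat family: the split isolates, it does not reduce. -/
theorem crux_iff_piece2_of_piece1 (h₁ : ResidualDischarge) :
    ResidualSectorComplement ↔ SummitOffFermatFourfolds :=
  ⟨summitOffFermatFourfolds_of_crux, fun h₂ => ResidualSectorComplement_of_subs h₁ h₂⟩

end Summit.HodgeConjecture.HodgeConjecture.Cruxes.ResidualSectorComplement.StrategistCensus
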